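import Literature.Computability.Cryptography.PseudorandomGeneratorsAnyOWF
import Literature.Computability.Cryptography.TreeSigInstance
import HarnessLib

/-!
# Discharges of named facts of `Schemes.lean`

`Literature/Computability/Cryptography/SchemesHolds.lean` — proofs-only sibling of
`Schemes.lean` (no definitions, no named facts). Each theorem below closes a named fact `X :
Prop` of that file as `X_holds : X` by composing an ACCEPTED reduction theorem of the tree
with the ACCEPTED unconditional `_holds` discharges of all of its hypotheses; nothing is
re-proved and no statement is changed. Recorded by the librarian sweep g25 (2026-08-16, pass
5c: facts dischargeable in one line from the tree's own lemmas), so that the facts census,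
`#h21_route_deps` and the cone guardrail see these facts as theorems.

Discharged here:

* `secureSignaturesExist_of_OWFExist_holds` := `secureSignaturesExist_of_OWFExist_of_HILL`
  `PRGExist_iff_OWFExist_holds` (`TreeSigInstance.lean`).

## References

* [Rompel1990] — see `lean/references.bib` and the docstring of the fact in `Schemes.lean`.
-/

namespace Literature.Computability.Cryptography

/-- **Discharge of the named fact `secureSignaturesExist_of_OWFExist`** (`Schemes.lean`):
crypto-foundations.S23 (OWF ⇒ signatures). If one-way functions exist then there is an
EUF-CMA-secure (existentially unforgeable under adaptive chosen-message attack) signature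
scheme. The proof chain in print is: … — obtained as
`secureSignaturesExist_of_OWFExist_of_HILL` applied to the tree's unconditional discharge
`PRGExist_iff_OWFExist_holds` of its hypothesis (reduction in `TreeSigInstance.lean`).
[cite: Rompel1990] -/
theorem secureSignaturesExist_of_OWFExist_holds :
    secureSignaturesExist_of_OWFExist :=
  secureSignaturesExist_of_OWFExist_of_HILL PRGExist_iff_OWFExist_holds

end Literature.Computability.Cryptography
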